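import Summits.ValiantsHypothesis.ValiantsHypothesis.Theorems.LacunarySymmetroidMatrixDescartesDoorA26WallBubblingClassMoments

/-!
# Wall bubbling for `DoorA26` — (W) chain piece: CLASS TOWER LIMIT (the analytic core of level selection)

HONEST FRAMING.  Chain lemma for obligation (W) `stub_weylFaces` of `Cruxes/DoorA26/Lines/wall_bubbling.lean` (stmt-ValiantsHypothesis-19979
`DoorA26`; OPEN, typed, never asserted), re-pointed seat val-sym-door-p1 g13 (W2 #8).  MIDDLE of the reduction «ConfluentDoor26 ⇒
Stmt.weylFaces_generic» (seat report DOOR-A-P1-REPORT §68 (g) steps (1)–(2)): inside ONE merging value class (member deviations `|ε_i^ν| ≤ w_ν → 0`,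
coefficients `a_i^ν`, cluster scale `μ_ν > 0`), IF the normalised moments converge — `(Σ_i a_i^ν (ε_i^ν)^m)/μ_ν → c_m` for `m < n` — and the tail
is controlled — `(Σ_i |a_i^ν|)·w_ν^n/μ_ν → 0` — THEN for every weight `r` the class functions `t ↦ (1/μ_ν) Σ_i a_i^ν (ε_i^ν)^r e^{ε_i^ν t}` converge
CONTINUOUSLY on every window (`t_k → t₀`, `|t_k| ≤ R`, along any subsequence) to `P^{(r)}(t₀) = Σ_{m'<n−r} c_{r+m'} t₀^{m'}/m'!`, `P = Σ_{m<n} c_m t^m/m!`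
(`classTower_limit`; the weights `ε^r` are what the `j`-th derivative of the cluster function puts on a class after the binomial expansion of
`(E + ε)^j`).  This is exactly the «continuous convergence of towers» hypothesis of W2 #5/#7 (`multiplicity_transfer`,
`no_twenty_window_of_confluentDoor`), class by class; the assembly over the value classes with the factors `e^{E_V t}·C(j,r)E_V^{j−r}` and the
identification of the limit tower with `iteratedDeriv j F` are finite bookkeeping left to the successor.  Input: W2 #6 `classMoment_taylor`.
No new definitions; nothing here bears on `DoorA26`, `MatrixDescartes` (stmt-ValiantsHypothesis-18050) or `VP ≠ VNP`.

[folklore] Taylor expansion with remainder; elementary limits.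
-/

-- `Summit.ValiantsHypothesis.ValiantsHypothesis.…` repeats a component by the D-0017 layout
-- (single-conjunct summit), which the `dupNamespace` linter flags; the name is mandated.
set_option linter.dupNamespace false

namespace Summit.ValiantsHypothesis.ValiantsHypothesis.Theorems.LacunarySymmetroidMatrixDescartes.WallBubbling

open Finset Filter Topology
open scoped BigOperators

/-- Tail bound: `|Σ_i a_i ε_i^r e^{ε_i t}| ≤ (Σ_i |a_i|)·w^r·e^{wR}` ≤ … for `|ε_i| ≤ w`, `|t| ≤ R`. [folklore] -/
theorem classTail_bound {ι : Type*} [Fintype ι] (a ε : ι → ℝ) (w R t : ℝ) (r : ℕ) (hw0 : 0 ≤ w)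
    (hw : ∀ i, |ε i| ≤ w) (ht : |t| ≤ R) :
    |∑ i, a i * ε i ^ r * Real.exp (ε i * t)| ≤ (∑ i, |a i|) * w ^ r * Real.exp (w * R) := by
  calc |∑ i, a i * ε i ^ r * Real.exp (ε i * t)|
      ≤ ∑ i, |a i * ε i ^ r * Real.exp (ε i * t)| := Finset.abs_sum_le_sum_abs _ _
    _ ≤ ∑ i, |a i| * w ^ r * Real.exp (w * R) := by
        refine Finset.sum_le_sum fun i _ => ?_
        rw [abs_mul, abs_mul, abs_of_pos (Real.exp_pos _), abs_pow]
        have h1 : |ε i| ^ r ≤ w ^ r := pow_le_pow_left₀ (abs_nonneg _) (hw i) r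
        have h2 : Real.exp (ε i * t) ≤ Real.exp (w * R) := by
          apply Real.exp_le_exp.mpr
          calc ε i * t ≤ |ε i * t| := le_abs_self _
            _ = |ε i| * |t| := abs_mul _ _
            _ ≤ w * R := mul_le_mul (hw i) ht (abs_nonneg _) hw0
        have ha : 0 ≤ |a i| := abs_nonneg _
        calc |a i| * |ε i| ^ r * Real.exp (ε i * t) ≤ |a i| * w ^ r * Real.exp (ε i * t) :=
              mul_le_mul_of_nonneg_right (mul_le_mul_of_nonneg_left h1 ha) (Real.exp_pos _).le
          _ ≤ |a i| * w ^ r * Real.exp (w * R) :=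
              mul_le_mul_of_nonneg_left h2 (mul_nonneg ha (pow_nonneg hw0 _))
    _ = (∑ i, |a i|) * w ^ r * Real.exp (w * R) := by rw [Finset.sum_mul, Finset.sum_mul]

/-- **CLASS TOWER LIMIT.**  See the module docstring. [folklore] -/
theorem classTower_limit {ι : Type*} [Fintype ι] (n : ℕ) (a ε : ℕ → ι → ℝ) (w μ : ℕ → ℝ) (c : ℕ → ℝ)
    (hμ : ∀ ν, 0 < μ ν) (hw0 : ∀ ν, 0 ≤ w ν) (hw : ∀ ν i, |ε ν i| ≤ w ν) (hwlim : Tendsto w atTop (𝓝 0))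
    (hmom : ∀ m < n, Tendsto (fun ν => (∑ i, a ν i * ε ν i ^ m) / μ ν) atTop (𝓝 (c m)))
    (htail : Tendsto (fun ν => (∑ i, |a ν i|) * w ν ^ n / μ ν) atTop (𝓝 0))
    (r : ℕ) (φ : ℕ → ℕ) (hφ : StrictMono φ) (R : ℝ) (t : ℕ → ℝ) (t₀ : ℝ) (htR : ∀ k, |t k| ≤ R)
    (htlim : Tendsto t atTop (𝓝 t₀)) :
    Tendsto (fun k => (∑ i, a (φ k) i * ε (φ k) i ^ r * Real.exp (ε (φ k) i * t k)) / μ (φ k)) atTop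
      (𝓝 (∑ m' ∈ Finset.range (n - r), c (r + m') * t₀ ^ m' / m'.factorial)) := by
  have hφt : Tendsto φ atTop atTop := hφ.tendsto_atTop
  have hR0 : 0 ≤ R := le_trans (abs_nonneg _) (htR 0)
  -- the tail along `φ`
  have htail' : Tendsto (fun k => (∑ i, |a (φ k) i|) * w (φ k) ^ n / μ (φ k)) atTop (𝓝 0) := htail.comp hφt
  have hw' : Tendsto (fun k => w (φ k)) atTop (𝓝 0) := hwlim.comp hφt
  -- eventually `w R ≤ 1`
  have hwR : ∀ᶠ k in atTop, w (φ k) * R ≤ 1 := by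
    have h1 : Tendsto (fun k => w (φ k) * R) atTop (𝓝 (0 * R)) := hw'.mul_const R
    rw [zero_mul] at h1
    exact (h1.eventually (Iic_mem_nhds zero_lt_one)).mono fun k hk => hk
  rcases Nat.lt_or_ge r n with hrn | hrn
  · -- main case `r < n`: Taylor to order `n - r` for the coefficients `a_i ε_i^r`
    have hnr : 0 < n - r := Nat.sub_pos_of_lt hrn
    -- the moment polynomial converges
    have hpoly : Tendsto (fun k => ∑ m' ∈ Finset.range (n - r),
        ((∑ i, a (φ k) i * ε (φ k) i ^ r * ε (φ k) i ^ m') / μ (φ k)) * t k ^ m' / m'.factorial) atTop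
        (𝓝 (∑ m' ∈ Finset.range (n - r), c (r + m') * t₀ ^ m' / m'.factorial)) := by
      refine tendsto_finsetSum _ fun m' hm' => ?_
      have hm'n : r + m' < n := by rw [Finset.mem_range] at hm'; omega
      have h1 : Tendsto (fun k => (∑ i, a (φ k) i * ε (φ k) i ^ r * ε (φ k) i ^ m') / μ (φ k)) atTop (𝓝 (c (r + m'))) := by
        have := (hmom (r + m') hm'n).comp hφt
        refine this.congr fun k => ?_
        simp only [Function.comp_apply]
        congr 1
        refine Finset.sum_congr rfl fun i _ => ?_
        rw [pow_add]; ring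
      exact ((h1.mul (htlim.pow m')).div_const _).congr fun k => by ring
    -- the remainder tends to zero
    have hrem : Tendsto (fun k => (∑ i, a (φ k) i * ε (φ k) i ^ r * Real.exp (ε (φ k) i * t k)) / μ (φ k)
        - ∑ m' ∈ Finset.range (n - r), ((∑ i, a (φ k) i * ε (φ k) i ^ r * ε (φ k) i ^ m') / μ (φ k)) * t k ^ m' / m'.factorial)
        atTop (𝓝 0) := by
      have hbound : ∀ᶠ k in atTop, |(∑ i, a (φ k) i * ε (φ k) i ^ r * Real.exp (ε (φ k) i * t k)) / μ (φ k)
          - ∑ m' ∈ Finset.range (n - r), ((∑ i, a (φ k) i * ε (φ k) i ^ r * ε (φ k) i ^ m') / μ (φ k)) * t k ^ m' / m'.factorial|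
          ≤ ((∑ i, |a (φ k) i|) * w (φ k) ^ n / μ (φ k)) * (R ^ (n - r) * (((n - r).succ : ℝ) / ((n - r).factorial * ((n - r : ℕ) : ℝ)))) := by
        filter_upwards [hwR] with k hk
        have hμk := hμ (φ k)
        -- Taylor for the coefficients `b_i = a_i ε_i^r`
        have hT := classMoment_taylor_window (fun i => a (φ k) i * ε (φ k) i ^ r) (ε (φ k)) (w (φ k)) R (t k) hnr
          (hw0 _) (hw _) (htR k) hk
        -- rewrite the difference as (Taylor difference) / μ
        have hdiff : (∑ i, a (φ k) i * ε (φ k) i ^ r * Real.exp (ε (φ k) i * t k)) / μ (φ k)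
            - ∑ m' ∈ Finset.range (n - r), ((∑ i, a (φ k) i * ε (φ k) i ^ r * ε (φ k) i ^ m') / μ (φ k)) * t k ^ m' / m'.factorial
            = ((∑ i, a (φ k) i * ε (φ k) i ^ r * Real.exp (ε (φ k) i * t k))
              - ∑ m' ∈ Finset.range (n - r), (∑ i, a (φ k) i * ε (φ k) i ^ r * ε (φ k) i ^ m') * t k ^ m' / m'.factorial) / μ (φ k) := by
          simp only [div_eq_mul_inv, sub_mul, Finset.sum_mul]
          congr 1
          refine Finset.sum_congr rfl fun m' _ => Finset.sum_congr rfl fun x _ => ?_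
          ring
        rw [hdiff, abs_div, abs_of_pos hμk, div_le_iff₀ hμk]
        refine hT.trans ?_
        -- compare the two right-hand sides
        have hsum : ∑ i, |a (φ k) i * ε (φ k) i ^ r| ≤ (∑ i, |a (φ k) i|) * w (φ k) ^ r := by
          rw [Finset.sum_mul]
          refine Finset.sum_le_sum fun i _ => ?_
          rw [abs_mul, abs_pow]
          exact mul_le_mul_of_nonneg_left (pow_le_pow_left₀ (abs_nonneg _) (hw _ i) r) (abs_nonneg _)
        have hC : 0 ≤ (((n - r).succ : ℝ) / ((n - r).factorial * ((n - r : ℕ) : ℝ))) := by positivity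
        have hwk := hw0 (φ k)
        calc (∑ i, |a (φ k) i * ε (φ k) i ^ r|) * (w (φ k) * R) ^ (n - r) * (((n - r).succ : ℝ) / ((n - r).factorial * ((n - r : ℕ) : ℝ)))
            ≤ ((∑ i, |a (φ k) i|) * w (φ k) ^ r) * (w (φ k) * R) ^ (n - r) * (((n - r).succ : ℝ) / ((n - r).factorial * ((n - r : ℕ) : ℝ))) := by
              apply mul_le_mul_of_nonneg_right _ hC
              exact mul_le_mul_of_nonneg_right hsum (pow_nonneg (mul_nonneg hwk hR0) _)
          _ = ((∑ i, |a (φ k) i|) * w (φ k) ^ n / μ (φ k)) * (R ^ (n - r) * (((n - r).succ : ℝ) / ((n - r).factorial * ((n - r : ℕ) : ℝ)))) * μ (φ k) := by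
              rw [mul_pow]
              have hn : w (φ k) ^ r * w (φ k) ^ (n - r) = w (φ k) ^ n := by rw [← pow_add, Nat.add_sub_cancel' hrn.le]
              field_simp
              rw [← hn]; ring
      have hlim0 : Tendsto (fun k => ((∑ i, |a (φ k) i|) * w (φ k) ^ n / μ (φ k)) *
          (R ^ (n - r) * (((n - r).succ : ℝ) / ((n - r).factorial * ((n - r : ℕ) : ℝ))))) atTop (𝓝 0) := by
        simpa using htail'.mul_const (R ^ (n - r) * (((n - r).succ : ℝ) / ((n - r).factorial * ((n - r : ℕ) : ℝ))))
      exact squeeze_zero_norm' hbound hlim0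
    have := hpoly.add hrem
    simpa using this
  · -- trivial case `n ≤ r`: the whole class function is a tail
    have hempty : Finset.range (n - r) = ∅ := by rw [Nat.sub_eq_zero_of_le hrn, Finset.range_zero]
    rw [hempty, Finset.sum_empty]
    have hbound : ∀ᶠ k in atTop, |(∑ i, a (φ k) i * ε (φ k) i ^ r * Real.exp (ε (φ k) i * t k)) / μ (φ k)|
        ≤ ((∑ i, |a (φ k) i|) * w (φ k) ^ n / μ (φ k)) * Real.exp 1 := by
      filter_upwards [hwR, hw'.eventually (Iic_mem_nhds zero_lt_one)] with k hk hk1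
      have hμk := hμ (φ k)
      have hwk := hw0 (φ k)
      rw [abs_div, abs_of_pos hμk, div_le_iff₀ hμk]
      refine (classTail_bound _ _ _ _ _ r hwk (hw _) (htR k)).trans ?_
      have h1 : w (φ k) ^ r ≤ w (φ k) ^ n := pow_le_pow_of_le_one hwk hk1 hrn
      have h2 : Real.exp (w (φ k) * R) ≤ Real.exp 1 := Real.exp_le_exp.mpr hk
      have hs : 0 ≤ ∑ i, |a (φ k) i| := Finset.sum_nonneg fun i _ => abs_nonneg _
      calc (∑ i, |a (φ k) i|) * w (φ k) ^ r * Real.exp (w (φ k) * R)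
          ≤ (∑ i, |a (φ k) i|) * w (φ k) ^ n * Real.exp 1 :=
            mul_le_mul (mul_le_mul_of_nonneg_left h1 hs) h2 (Real.exp_pos _).le (mul_nonneg hs (pow_nonneg hwk _))
        _ = ((∑ i, |a (φ k) i|) * w (φ k) ^ n / μ (φ k)) * Real.exp 1 * μ (φ k) := by field_simp
    have hlim0 : Tendsto (fun k => ((∑ i, |a (φ k) i|) * w (φ k) ^ n / μ (φ k)) * Real.exp 1) atTop (𝓝 0) := by
      simpa using htail'.mul_const (Real.exp 1)
    exact squeeze_zero_norm' hbound hlim0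

end Summit.ValiantsHypothesis.ValiantsHypothesis.Theorems.LacunarySymmetroidMatrixDescartes.WallBubbling
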